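import Summits.QuantumFields.YangMills.Theorems.BalabanLadderIRTwistedSlabHaarSliceChart
import HarnessLib

/-!
# The slice chart in B89's currency, III: the chart as the ORBIT MAP `(φ, y) ↦ e^{φ} • (e^{y}·L)` (continuous, `SU(N)^E`-valued), the
# density at the origin (`J(0) = σ₀ > 0`), and the FIBRED form of the `hchart` identity on an `L²`-product model `M × V` with the product
# Lebesgue measure — the exact input format of lit-4's L9 `tendsto_laplaceMethod_fibred_chart`

HELPER toward stub **T1** `TwistedSlabAnchor` (LINE `twisted-slab-continuity`, crux `IRcof` stmt-QuantumFields-26930, census row 43;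
LEAD prover ym-ir-line-tsc-p1 g3; `--supports` the crux, `--as helper`).  Sequel of `…TwistedSlabModelChart` ∕ `…TwistedSlabHaarSliceChart` (K16a/b);
uses Mathlib's `WithLp.volume_preserving_toLp` (the `L²`-product of two Euclidean models has the product Lebesgue measure) and Lusin–Souslin
(`MeasurableSet.image_of_continuousOn_injOn`) BY NAME.  Scope `Matrix.Norms.L2Operator`.
* §1 `orbitCfg hL q = (e ↦ orbitFluct L q (e.2, e.1)) ∈ SU(N)^E` for `𝔰𝔲` data `q` (K15a `orbitFluct_mem_specialUnitaryGroup`), `coe_orbitCfg_apply`,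
  `continuous_orbitCfg`; `sliceChartDensity_zero` (`J(0) = σ₀`, the window constant: `D(modelPsi)(0) = id`, `jac 0 = 1`) and
  `sliceChartDensity_zero_pos` (`J(0) > 0`).
* §2 (frame `T : WithLp 2 (M × V) ≃L[ℝ] suFields × realCoulombSlice L` on the `L²`-product of two finite-dimensional real inner-product spaces)
  `fibredChartMap hL T : M × V → SU(N)^E` (`= orbitCfg ∘ T ∘ toLp`, CONTINUOUS — hence measurable, as L9 requires), `fibredChartDensity`,
  ★★★ `haar_restrict_fibredChartMap_image_eq_map_withDensity`: an open `W ∋ 0` in `M × V` with `InjOn`, continuous density, MEASURABLE image, and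
  `μ|_{Ψ(W)} = Ψ_*((J · (vol_M ⊗ vol_V))|_W)` — `volume` on `M × V` IS `volume.prod volume`, the `(ν.prod volume)` of L9; ★★★ `_ladder` version.
NOT here (honest scope): the choice `M ≅ suFields`, `V ≅ realCoulombSlice` (any linear frames will do; orthogonality is not needed for L9), the
Faddeev–Popov localisation (lit-4 L15) and the assembly of L9 (phase `p`-independence by gauge invariance, `hS2`/`hcoer` from K5/K13, `hsep`/`hout`
from K7, `det` from K8) = T1-tree-exact; anything uniform in `β` (M3); the cluster expansion (M4); T1-box 0∕1, T1 proper 0∕1.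

HONEST FRAMING: measure-theoretic plumbing on one box; nothing here bears on `IRcof`, `IR`, or the Yang–Mills mass gap (Clay: NOT proved); R4 =
`BalabanLadder.UV` only.  References: S. Helgason, *Groups and Geometric Analysis* Ch. I §1 Thm 1.14 (13) p. 96; K. W. Breitung, *Asymptotic
Approximations for Probability Integrals* (1994) §2.3, Thm 41; E. Hasenpflug, D. Rudolf, B. Sprungk, §3.1 Assumption 3 (tubular coordinates).
-/

set_option autoImplicit false

noncomputable section

open scoped Matrix Matrix.Norms.L2Operator Topology ENNReal
open MeasureTheory Filter NormedSpace Set WithLp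
open Literature.MathematicalPhysics.QuantumFieldTheory Literature.MathematicalPhysics.QuantumLattice
open Literature.Analysis.OperatorTheory
open Literature.MathematicalPhysics.QuantumFieldTheory.Balaban1983to89
open Literature.MathematicalPhysics.QuantumFieldTheory.Balaban1983to89.HaarExponentialChart
open Literature.MathematicalPhysics.QuantumFieldTheory.Balaban1983to89.LogChartProduct
open Literature.MathematicalPhysics.QuantumFieldTheory.Balaban1983to89.B13HaarSigmaJacobian (jac jac_zero det_jac_zero)
open Literature.Analysis.Asymptotics

namespace Summit.QuantumFields.YangMills.Cruxes.IRcof.TwistedSlab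

variable {N : ℕ} [NeZero N] {n₀ n₁ n₂ n₃ : ℕ}

/-! ## §1 The orbit configuration map and the density at the origin -/

section Orbit

variable {L : FinTorusSite n₀ n₁ n₂ n₃ × Fin 4 → Matrix (Fin N) (Fin N) ℂ}

omit [NeZero N] in
/-- **The orbit configuration of `𝔰𝔲` data**: `orbitCfg hL (φ, y) = (e ↦ e^{φ(x)} e^{y_μ(x)} L(x,μ) e^{−φ(x+e_μ)})`, `e = (x, μ)`, an `SU(N)^E`-valued
configuration (K15a `orbitFluct_mem_specialUnitaryGroup`). [cite: GarciaperezGonzalezarroyoOkawa2017, §2.3, §2.5] -/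
def orbitCfg (hL : ∀ e, L e ∈ Matrix.specialUnitaryGroup (Fin N) ℂ) (q : suFields N n₀ n₁ n₂ n₃ × realCoulombSlice L) :
    FinTorusSite n₀ n₁ n₂ n₃ × Fin 4 → Matrix.specialUnitaryGroup (Fin N) ℂ :=
  fun e => ⟨orbitFluct L (suDataIncl L q) e.2 e.1,
    orbitFluct_mem_specialUnitaryGroup hL (p := suDataIncl L q) (fun x => q.1.2 x) (fun μ x => (q.2.2).1 μ x) e.2 e.1⟩

omit [NeZero N] in
/-- Links of the orbit configuration. [folklore] -/
@[simp] theorem coe_orbitCfg_apply (hL : ∀ e, L e ∈ Matrix.specialUnitaryGroup (Fin N) ℂ) (q : suFields N n₀ n₁ n₂ n₃ × realCoulombSlice L)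
    (e : FinTorusSite n₀ n₁ n₂ n₃ × Fin 4) :
    ((orbitCfg hL q e : Matrix.specialUnitaryGroup (Fin N) ℂ) : Matrix (Fin N) (Fin N) ℂ) = orbitFluct L (suDataIncl L q) e.2 e.1 := rfl

omit [NeZero N] in
/-- The orbit configuration map is continuous. [folklore] -/
theorem continuous_orbitCfg (hL : ∀ e, L e ∈ Matrix.specialUnitaryGroup (Fin N) ℂ) : Continuous (orbitCfg hL) := by
  refine continuous_pi fun e => Continuous.subtype_mk ?_ _
  -- (continuity from scratch in this norm scope: three exponentials of continuous linear data times a constant)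
  letI : NormedAlgebra ℚ (Matrix (Fin N) (Fin N) ℂ) := NormedAlgebra.restrictScalars ℚ ℂ (Matrix (Fin N) (Fin N) ℂ)
  have hι : Continuous (suDataIncl L) := (suDataIncl L).continuous
  have h1 : Continuous fun q : suFields N n₀ n₁ n₂ n₃ × realCoulombSlice L => (suDataIncl L q).1 e.1 :=
    (continuous_apply e.1).comp (continuous_fst.comp hι)
  have h2 : Continuous fun q : suFields N n₀ n₁ n₂ n₃ × realCoulombSlice L => (suDataIncl L q).2 e.2 e.1 :=
    (continuous_apply e.1).comp ((continuous_apply e.2).comp (continuous_snd.comp hι))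
  have h3 : Continuous fun q : suFields N n₀ n₁ n₂ n₃ × realCoulombSlice L => (suDataIncl L q).1 (e.1.shift e.2) :=
    (continuous_apply (e.1.shift e.2)).comp (continuous_fst.comp hι)
  show Continuous fun q : suFields N n₀ n₁ n₂ n₃ × realCoulombSlice L =>
    exp ((suDataIncl L q).1 e.1) * exp ((suDataIncl L q).2 e.2 e.1) * L (e.1, e.2) * exp (-((suDataIncl L q).1 (e.1.shift e.2)))
  exact (((exp_continuous.comp h1).mul (exp_continuous.comp h2)).mul continuous_const).mul (exp_continuous.comp h3.neg)

variable {V : Type*} [NormedAddCommGroup V] [InnerProductSpace ℝ V] [FiniteDimensional ℝ V] [MeasurableSpace V] [BorelSpace V]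
variable (hLsu : ∀ e, L e ∈ Matrix.specialUnitaryGroup (Fin N) ℂ)
  (D : (suFields N n₀ n₁ n₂ n₃ × realCoulombSlice L) ≃L[ℝ] (Fin 4 → suFields N n₀ n₁ n₂ n₃))
  (T : V ≃L[ℝ] (suFields N n₀ n₁ n₂ n₃ × realCoulombSlice L))

/-- **The density at the origin is the window constant**: `J(0) = σ₀ = μ(V_s)∕ν_s(V_s)` when `D = DΨ̂(0)` (`D(modelPsi)(0) = id`, `modelPsi 0 = 0`,
`jac 0 = 1`). [cite: Helgason2000, Ch. I §1 Thm 1.14 (13) p. 96] -/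
theorem sliceChartDensity_zero (hD : fderiv ℝ (slicePsiSu L) 0 = (D : _ →L[ℝ] (Fin 4 → suFields N n₀ n₁ n₂ n₃)))
    (μ : Measure (FinTorusSite n₀ n₁ n₂ n₃ × Fin 4 → Matrix.specialUnitaryGroup (Fin N) ℂ)) :
    letI : MeasurableSpace (piLogChart (specialUnitaryLogChart (Fin N)) (FinTorusSite n₀ n₁ n₂ n₃ × Fin 4)).lie := borel _
    haveI : BorelSpace (piLogChart (specialUnitaryLogChart (Fin N)) (FinTorusSite n₀ n₁ n₂ n₃ × Fin 4)).lie := ⟨rfl⟩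
    sliceChartDensity hLsu D T μ 0 =
      (μ ((isChartRep_pi (FinTorusSite n₀ n₁ n₂ n₃ × Fin 4) (isChartRep_specialUnitaryGroup (n := Fin N))).window
          (IsChartRep.chartRadius (piLogChart (specialUnitaryLogChart (Fin N)) (FinTorusSite n₀ n₁ n₂ n₃ × Fin 4)))) /
        (isChartRep_pi (FinTorusSite n₀ n₁ n₂ n₃ × Fin 4) (isChartRep_specialUnitaryGroup (n := Fin N))).chartMeasure
          (lie_adStable_pi (specialUnitaryLogChart (Fin N)) (FinTorusSite n₀ n₁ n₂ n₃ × Fin 4) (lie_adStable_specialUnitaryGroup (n := Fin N)))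
          ((volume : Measure V).map (modelFrame (fun e => (Matrix.mem_specialUnitaryGroup_iff.1 (hLsu e)).1) D T))
          (IsChartRep.chartRadius (piLogChart (specialUnitaryLogChart (Fin N)) (FinTorusSite n₀ n₁ n₂ n₃ × Fin 4)))
          ((isChartRep_pi (FinTorusSite n₀ n₁ n₂ n₃ × Fin 4) (isChartRep_specialUnitaryGroup (n := Fin N))).window
            (IsChartRep.chartRadius (piLogChart (specialUnitaryLogChart (Fin N)) (FinTorusSite n₀ n₁ n₂ n₃ × Fin 4))))).toReal := by
  have hLu : ∀ e, L e ∈ Matrix.unitaryGroup (Fin N) ℂ := fun e => (Matrix.mem_specialUnitaryGroup_iff.1 (hLsu e)).1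
  have h1 : fderiv ℝ (modelPsi D T) 0 = ContinuousLinearMap.id ℝ V := fderiv_modelPsi_zero D T hD
  have h2 : modelFrame hLu D T (modelPsi D T 0) = 0 := by rw [modelPsi_zero D T hLu, map_zero]
  simp only [sliceChartDensity, h1, h2, det_jac_zero, ContinuousLinearMap.det, ContinuousLinearMap.coe_id, LinearMap.det_id, abs_one, one_mul,
    mul_one]

/-- **The density at the origin is positive** (`σ₀ ≠ 0, ∞` for a Haar `μ` and the frame's Lebesgue measure, an additive Haar measure on `𝔤^E`).
[cite: Helgason2000, Ch. I §1 Thm 1.14 (13) p. 96] -/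
theorem sliceChartDensity_zero_pos (hD : fderiv ℝ (slicePsiSu L) 0 = (D : _ →L[ℝ] (Fin 4 → suFields N n₀ n₁ n₂ n₃)))
    (μ : Measure (FinTorusSite n₀ n₁ n₂ n₃ × Fin 4 → Matrix.specialUnitaryGroup (Fin N) ℂ)) [μ.IsHaarMeasure] :
    0 < sliceChartDensity hLsu D T μ 0 := by
  letI : MeasurableSpace (piLogChart (specialUnitaryLogChart (Fin N)) (FinTorusSite n₀ n₁ n₂ n₃ × Fin 4)).lie := borel _
  haveI : BorelSpace (piLogChart (specialUnitaryLogChart (Fin N)) (FinTorusSite n₀ n₁ n₂ n₃ × Fin 4)).lie := ⟨rfl⟩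
  have hLu : ∀ e, L e ∈ Matrix.unitaryGroup (Fin N) ℂ := fun e => (Matrix.mem_specialUnitaryGroup_iff.1 (hLsu e)).1
  haveI : ((volume : Measure V).map (modelFrame hLu D T)).IsAddHaarMeasure := (modelFrame hLu D T).isAddHaarMeasure_map _
  have h := sliceChartDensity_zero hLsu D T hD μ
  rw [h]
  have hc := (isChartRep_pi (FinTorusSite n₀ n₁ n₂ n₃ × Fin 4) (isChartRep_specialUnitaryGroup (n := Fin N))).windowConst_ne_zero_and_ne_top
    (lie_adStable_pi (specialUnitaryLogChart (Fin N)) (FinTorusSite n₀ n₁ n₂ n₃ × Fin 4) (lie_adStable_specialUnitaryGroup (n := Fin N)))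
    ((volume : Measure V).map (modelFrame hLu D T)) μ
    (IsChartRep.chartRadius_pos (C := piLogChart (specialUnitaryLogChart (Fin N)) (FinTorusSite n₀ n₁ n₂ n₃ × Fin 4))) le_rfl
  exact ENNReal.toReal_pos hc.1 hc.2

end Orbit

/-! ## §2 The fibred form on an `L²`-product model `M × V` (product Lebesgue measure) -/

section Fibred

variable {L : FinTorusSite n₀ n₁ n₂ n₃ × Fin 4 → Matrix (Fin N) (Fin N) ℂ}
variable {M : Type*} [NormedAddCommGroup M] [InnerProductSpace ℝ M] [FiniteDimensional ℝ M] [MeasurableSpace M] [BorelSpace M]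
variable {V : Type*} [NormedAddCommGroup V] [InnerProductSpace ℝ V] [FiniteDimensional ℝ V] [MeasurableSpace V] [BorelSpace V]
variable (hLsu : ∀ e, L e ∈ Matrix.specialUnitaryGroup (Fin N) ℂ)
  (D : (suFields N n₀ n₁ n₂ n₃ × realCoulombSlice L) ≃L[ℝ] (Fin 4 → suFields N n₀ n₁ n₂ n₃))
  (T : WithLp 2 (M × V) ≃L[ℝ] (suFields N n₀ n₁ n₂ n₃ × realCoulombSlice L))

omit [NeZero N] [FiniteDimensional ℝ M] [MeasurableSpace M] [BorelSpace M] [FiniteDimensional ℝ V] [MeasurableSpace V] [BorelSpace V] in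
/-- **The fibred chart map** `Ψ(p, y) = orbitCfg (T (p, y))` on the product model (continuous, hence measurable — as L9 requires).
[cite: Breitung1994, §2.3 Definitions 4–5 pp. 14–15] -/
def fibredChartMap : M × V → (FinTorusSite n₀ n₁ n₂ n₃ × Fin 4 → Matrix.specialUnitaryGroup (Fin N) ℂ) :=
  fun py => orbitCfg hLsu (T (toLp 2 py))

/-- **The fibred density** `J(p, y) = sliceChartDensity (toLp (p, y))`. [cite: Breitung1994, Thm 41 p. 56] -/
def fibredChartDensity (μ : Measure (FinTorusSite n₀ n₁ n₂ n₃ × Fin 4 → Matrix.specialUnitaryGroup (Fin N) ℂ)) : M × V → ℝ :=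
  fun py => sliceChartDensity hLsu D T μ (toLp 2 py)

omit [NeZero N] [FiniteDimensional ℝ M] [MeasurableSpace M] [BorelSpace M] [FiniteDimensional ℝ V] [MeasurableSpace V] [BorelSpace V] in
/-- Links of the fibred chart map. [folklore] -/
theorem coe_fibredChartMap_apply (py : M × V) (e : FinTorusSite n₀ n₁ n₂ n₃ × Fin 4) :
    ((fibredChartMap hLsu T py e : Matrix.specialUnitaryGroup (Fin N) ℂ) : Matrix (Fin N) (Fin N) ℂ) =
      orbitFluct L (suDataIncl L (T (toLp 2 py))) e.2 e.1 := rfl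

omit [NeZero N] [FiniteDimensional ℝ M] [MeasurableSpace M] [BorelSpace M] [FiniteDimensional ℝ V] [MeasurableSpace V] [BorelSpace V] in
/-- The fibred chart map is continuous. [folklore] -/
theorem continuous_fibredChartMap : Continuous (fibredChartMap hLsu T) :=
  (continuous_orbitCfg hLsu).comp (T.continuous.comp (WithLp.prodContinuousLinearEquiv 2 ℝ M V).symm.continuous)

omit [NeZero N] [FiniteDimensional ℝ M] [MeasurableSpace M] [BorelSpace M] [FiniteDimensional ℝ V] [MeasurableSpace V] [BorelSpace V] in
/-- `Ψ(0) = L` (as a configuration). [folklore] -/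
theorem fibredChartMap_zero : fibredChartMap hLsu T 0 = fun e => ⟨L e, hLsu e⟩ := by
  funext e; apply Subtype.ext
  rw [coe_fibredChartMap_apply, toLp_zero, map_zero, map_zero, orbitFluct_zero]

/-- ★★★ **THE FIBRED `hchart` IDENTITY** (`L ∈ SU(N)^E`, `S ∋ 0` open with `Ψ̂` injective on `S`; any frame `T` of the `𝔰𝔲` data by the `L²`-product
`WithLp 2 (M × V)` of two finite-dimensional real inner-product spaces; any Haar measure `μ` on `SU(N)^E`): an open `W ∋ 0` in `M × V` on which the
fibred chart map `Ψ = orbitCfg ∘ T ∘ toLp` is injective, the density `J` is continuous, `Ψ(W)` is measurable, and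
`μ|_{Ψ(W)} = Ψ_*((J · volume)|_W)` with `volume = vol_M ⊗ vol_V` on `M × V` — the `hchart` hypothesis of lit-4's `tendsto_laplaceMethod_fibred_chart`.
Proof: K16b on the model `WithLp 2 (M × V)`, transported along the volume-preserving `toLp` (Mathlib `WithLp.volume_preserving_toLp`), with the
chart map replaced by the continuous orbit map (equal on the window) and the density by a measurable modification; Lusin–Souslin for the image.
[cite: Helgason2000, Ch. I §1 Thm 1.14 (13) p. 96] [cite: Breitung1994, §2.3 Definitions 4–5 pp. 14–15; Thm 41 p. 56] [cite: HasenpflugRudolfSprungk2024, §3.1 Assumption 3 (T)] -/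
theorem haar_restrict_fibredChartMap_image_eq_map_withDensity
    {S : Set (suFields N n₀ n₁ n₂ n₃ × realCoulombSlice L)} (hSo : IsOpen S)
    (hS0 : (0 : suFields N n₀ n₁ n₂ n₃ × realCoulombSlice L) ∈ S) (hSinj : InjOn (slicePsiSu L) S)
    (μ : Measure (FinTorusSite n₀ n₁ n₂ n₃ × Fin 4 → Matrix.specialUnitaryGroup (Fin N) ℂ)) [μ.IsHaarMeasure] :
    ∃ W : Set (M × V), IsOpen W ∧ (0 : M × V) ∈ W ∧ InjOn (fibredChartMap hLsu T) W ∧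
      ContinuousOn (fibredChartDensity hLsu D T μ) W ∧ MeasurableSet (fibredChartMap hLsu T '' W) ∧
      μ.restrict (fibredChartMap hLsu T '' W) =
        (((volume : Measure (M × V)).restrict W).withDensity fun z => ENNReal.ofReal (fibredChartDensity hLsu D T μ z)).map
          (fibredChartMap hLsu T) := by
  classical
  obtain ⟨W₀, hW₀o, hW₀0, hinj₀, hcont₀, hlinks, hchart₀⟩ :=
    haar_restrict_sliceChartMap_image_eq_map_withDensity hLsu D T hSo hS0 hSinj μ
  have hW₀m : MeasurableSet W₀ := hW₀o.measurableSet
  -- the transport map `σ = toLp 2 : M × V → WithLp 2 (M × V)` (a homeomorphism, volume-preserving)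
  have hσc : Continuous (toLp 2 : M × V → WithLp 2 (M × V)) := (WithLp.prodContinuousLinearEquiv 2 ℝ M V).symm.continuous
  have hσm : Measurable (toLp 2 : M × V → WithLp 2 (M × V)) := hσc.measurable
  have hσmp : MeasurePreserving (toLp 2 : M × V → WithLp 2 (M × V)) volume volume := WithLp.volume_preserving_toLp M V
  have hσemb : MeasurableEmbedding (toLp 2 : M × V → WithLp 2 (M × V)) := (MeasurableEquiv.toLp 2 (M × V)).measurableEmbedding
  have hσsurj : Function.Surjective (toLp 2 : M × V → WithLp 2 (M × V)) := (MeasurableEquiv.toLp 2 (M × V)).surjective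
  -- the window in the product model
  set W : Set (M × V) := (toLp 2) ⁻¹' W₀ with hWdef
  have hWo : IsOpen W := hW₀o.preimage hσc
  have hWm : MeasurableSet W := hWo.measurableSet
  have hW0 : (0 : M × V) ∈ W := by show toLp 2 (0 : M × V) ∈ W₀; rw [toLp_zero]; exact hW₀0
  -- on the window the fibred chart map is the slice-chart map read through `σ`
  have hΦ' : EqOn (fun z => orbitCfg hLsu (T z)) (sliceChartMap hLsu D T) W₀ := fun z hz => by
    funext e; apply Subtype.ext
    rw [coe_orbitCfg_apply, hlinks z hz e.1 e.2]
  have hΨW : EqOn (fibredChartMap hLsu T) (sliceChartMap hLsu D T ∘ toLp 2) W := fun py hpy => hΦ' hpy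
  have himgσ : (toLp 2 : M × V → WithLp 2 (M × V)) '' W = W₀ := Set.image_preimage_eq W₀ hσsurj
  have himg : fibredChartMap hLsu T '' W = sliceChartMap hLsu D T '' W₀ := by
    rw [hΨW.image_eq, Set.image_comp, himgσ]
  refine ⟨W, hWo, hW0, ?_, ?_, ?_, ?_⟩
  · -- injectivity
    exact ((hinj₀.comp (MeasurableEquiv.toLp 2 (M × V)).injective.injOn fun py hpy => hpy).congr hΨW.symm :)
  · -- continuity of the density
    exact hcont₀.comp hσc.continuousOn fun py hpy => hpy
  · -- measurability of the image (Lusin–Souslin)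
    exact hWm.image_of_continuousOn_injOn (continuous_fibredChartMap hLsu T).continuousOn
      (((hinj₀.comp (MeasurableEquiv.toLp 2 (M × V)).injective.injOn fun py hpy => hpy).congr hΨW.symm :))
  · -- the chart identity, transported along `σ`
    -- a measurable modification of the density off `W₀`
    set J₁ : WithLp 2 (M × V) → ℝ := W₀.piecewise (sliceChartDensity hLsu D T μ) (fun _ => 0) with hJ₁
    have hJ₁m : Measurable J₁ := hcont₀.measurable_piecewise continuousOn_const hW₀m
    have hJ₁W : EqOn J₁ (sliceChartDensity hLsu D T μ) W₀ := Set.piecewise_eqOn W₀ _ _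
    have hJ₁m' : Measurable fun z => ENNReal.ofReal (J₁ z) := hJ₁m.ennreal_ofReal
    -- (1) replace the density by `J₁ ∘ σ` and the map by `Φ' ∘ σ`
    have h1 : (((volume : Measure (M × V)).restrict W).withDensity fun z => ENNReal.ofReal (fibredChartDensity hLsu D T μ z)) =
        ((volume : Measure (M × V)).restrict W).withDensity ((fun z => ENNReal.ofReal (J₁ z)) ∘ toLp 2) := by
      refine withDensity_congr_ae (ae_restrict_of_forall_mem hWm fun py hpy => ?_)
      show ENNReal.ofReal (sliceChartDensity hLsu D T μ (toLp 2 py)) = ENNReal.ofReal (J₁ (toLp 2 py))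
      rw [hJ₁W hpy]
    have h2 : Measure.map (fibredChartMap hLsu T)
        (((volume : Measure (M × V)).restrict W).withDensity ((fun z => ENNReal.ofReal (J₁ z)) ∘ toLp 2)) =
        Measure.map ((fun z => orbitCfg hLsu (T z)) ∘ toLp 2)
        (((volume : Measure (M × V)).restrict W).withDensity ((fun z => ENNReal.ofReal (J₁ z)) ∘ toLp 2)) := rfl
    -- (2) push forward along `σ`: `σ_*((J₁∘σ) · vol|_W) = J₁ · vol_tot|_{W₀}`
    have h3 : Measure.map (toLp 2) (((volume : Measure (M × V)).restrict W).withDensity ((fun z => ENNReal.ofReal (J₁ z)) ∘ toLp 2)) =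
        ((volume : Measure (WithLp 2 (M × V))).restrict W₀).withDensity fun z => ENNReal.ofReal (J₁ z) := by
      rw [← withDensity_map_eq_map_withDensity_comp hσm hJ₁m', ← hσemb.restrict_map, hσmp.map_eq]
    -- (3) assemble
    have hΦ'c : Continuous fun z => orbitCfg hLsu (T z) := (continuous_orbitCfg hLsu).comp T.continuous
    rw [h1, h2, ← Measure.map_map hΦ'c.measurable hσm, h3, himg, hchart₀]
    -- the two sides now differ by `Φ'` vs the slice-chart map and `J₁` vs `J` on `W₀`
    have h4 : ((volume : Measure (WithLp 2 (M × V))).restrict W₀).withDensity (fun z => ENNReal.ofReal (J₁ z)) =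
        ((volume : Measure (WithLp 2 (M × V))).restrict W₀).withDensity fun z => ENNReal.ofReal (sliceChartDensity hLsu D T μ z) :=
      withDensity_congr_ae (ae_restrict_of_forall_mem hW₀m fun z hz => by
        show ENNReal.ofReal (J₁ z) = ENNReal.ofReal (sliceChartDensity hLsu D T μ z)
        rw [hJ₁W hz])
    rw [h4]
    refine Measure.map_congr ((withDensity_absolutelyContinuous _ _).ae_eq ?_)
    exact (ae_restrict_mem hW₀m).mono fun z hz => (hΦ' hz).symm

end Fibred

/-! ## §3 At the twist-eating ladder -/

section Ladder

variable {m n₂' n₃' : ℕ} {A B : Matrix (Fin N) (Fin N) ℂ} {ω : ℂ} {Γ₂ Γ₃ : Matrix (Fin N) (Fin N) ℂ}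
variable {M : Type*} [NormedAddCommGroup M] [InnerProductSpace ℝ M] [FiniteDimensional ℝ M] [MeasurableSpace M] [BorelSpace M]
variable {V : Type*} [NormedAddCommGroup V] [InnerProductSpace ℝ V] [FiniteDimensional ℝ V] [MeasurableSpace V] [BorelSpace V]

/-- ★★★ **THE FIBRED `hchart` IDENTITY AT THE TWIST-EATING LADDER** (`A, B` a unitary Weyl pair, `ω` primitive, `N(m+1) ≥ 2`, ladder in `SU(N)`;
`D = DΨ̂(0)`, chart data from the inverse function theorem): for every frame `T` of the `𝔰𝔲` data by an `L²`-product model `M × V` and every Haar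
measure `μ` on `SU(N)^E`, an open `W ∋ 0` with `InjOn`, continuous density, measurable image and `μ|_{Ψ(W)} = Ψ_*((J · (vol_M ⊗ vol_V))|_W)` for
the orbit map `Ψ(p, y) = e^{φ} • (e^{y}·L)`, `(φ, y) = T(p, y)`. [cite: Helgason2000, Ch. I §1 Thm 1.14 (13) p. 96] [cite: Breitung1994, Thm 41 p. 56]
[cite: GarciaperezGonzalezarroyoOkawa2017, §2.3, §2.5] -/
theorem haar_restrict_fibredChartMap_image_eq_map_withDensity_ladder (hAu : A ∈ Matrix.unitaryGroup (Fin N) ℂ)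
    (hBu : B ∈ Matrix.unitaryGroup (Fin N) ℂ) (hω : IsPrimitiveRoot ω N) (hAB : A * B = ω • (B * A)) (hNm : 2 ≤ N * (m + 1))
    (hL : ∀ e, ladderField (n₀ := m + 1) (n₁ := m + 1) (n₂ := n₂') (n₃ := n₃') ![A, B, Γ₂, Γ₃] e ∈ Matrix.specialUnitaryGroup (Fin N) ℂ)
    (T : WithLp 2 (M × V) ≃L[ℝ] (suFields N (m + 1) (m + 1) n₂' n₃' ×
      realCoulombSlice (ladderField (n₀ := m + 1) (n₁ := m + 1) (n₂ := n₂') (n₃ := n₃') ![A, B, Γ₂, Γ₃])))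
    (μ : Measure (FinTorusSite (m + 1) (m + 1) n₂' n₃' × Fin 4 → Matrix.specialUnitaryGroup (Fin N) ℂ)) [μ.IsHaarMeasure] :
    ∃ W : Set (M × V), IsOpen W ∧ (0 : M × V) ∈ W ∧ InjOn (fibredChartMap hL T) W ∧
      ContinuousOn (fibredChartDensity hL (slicePsiSuDeriv hAu hBu hω hAB hNm hL) T μ) W ∧ MeasurableSet (fibredChartMap hL T '' W) ∧
      μ.restrict (fibredChartMap hL T '' W) =
        (((volume : Measure (M × V)).restrict W).withDensity fun z =>
            ENNReal.ofReal (fibredChartDensity hL (slicePsiSuDeriv hAu hBu hω hAB hNm hL) T μ z)).map (fibredChartMap hL T) :=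
  haar_restrict_fibredChartMap_image_eq_map_withDensity hL (slicePsiSuDeriv hAu hBu hω hAB hNm hL) T
    (isOpen_sliceChart_source hAu hBu hω hAB hNm hL) (zero_mem_sliceChart_source hAu hBu hω hAB hNm hL)
    (injOn_slicePsiSu_sliceChart_source hAu hBu hω hAB hNm hL) μ

/-- At the twist-eating ladder the fibred density at the origin is the (positive) window constant. [cite: Helgason2000, Ch. I §1 Thm 1.14 (13) p. 96] -/
theorem fibredChartDensity_zero_pos_ladder (hAu : A ∈ Matrix.unitaryGroup (Fin N) ℂ)
    (hBu : B ∈ Matrix.unitaryGroup (Fin N) ℂ) (hω : IsPrimitiveRoot ω N) (hAB : A * B = ω • (B * A)) (hNm : 2 ≤ N * (m + 1))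
    (hL : ∀ e, ladderField (n₀ := m + 1) (n₁ := m + 1) (n₂ := n₂') (n₃ := n₃') ![A, B, Γ₂, Γ₃] e ∈ Matrix.specialUnitaryGroup (Fin N) ℂ)
    (T : WithLp 2 (M × V) ≃L[ℝ] (suFields N (m + 1) (m + 1) n₂' n₃' ×
      realCoulombSlice (ladderField (n₀ := m + 1) (n₁ := m + 1) (n₂ := n₂') (n₃ := n₃') ![A, B, Γ₂, Γ₃])))
    (μ : Measure (FinTorusSite (m + 1) (m + 1) n₂' n₃' × Fin 4 → Matrix.specialUnitaryGroup (Fin N) ℂ)) [μ.IsHaarMeasure] :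
    0 < fibredChartDensity hL (slicePsiSuDeriv hAu hBu hω hAB hNm hL) T μ 0 := by
  rw [fibredChartDensity, toLp_zero]
  exact sliceChartDensity_zero_pos hL _ T (fderiv_slicePsiSu_zero hAu hBu hω hAB hNm hL) μ

end Ladder

end Summit.QuantumFields.YangMills.Cruxes.IRcof.TwistedSlab

end
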